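import Literature.Barriers.CriticalPhenomena.LongRangeTrivialityOnZ3Inputs
import Literature.Probability.LatticeModels.HighDimTrivialityMoments
import Mathlib.Probability.ProbabilityMassFunction.Integrals

/-!
# Panis's moment-generating-function bound from the moment-level facts: the window law of the
# infinite-volume state, flip symmetry, Newman's Gaussian domination, and the tree's summation step

Sibling of `Literature/Barriers/CriticalPhenomena/LongRangeTrivialityOnZ3.lean` (barrier catalogue
D-0021, sub-problem `Ising3DConformalLimit`). `LongRangeTrivialityOnZ3Inputs.lean` reduced the barrier's
single remaining input `panis_thm12` (Panis 2023, Theorem 1.2) to the two printed displays of the proof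
of Theorem 5.5: the moment-generating-function bound `panis_mgfDeviation_le_ursellFourBoxSum` (p. 21)
and the bound `panis_ursellFourBoxSum_le` on `S(β,L,f) = Σ_L⁻²∑|U₄|` (p. 22). This file performs, for
the long-range pair interactions of the barrier, the **moment-level split** that the tree already has
for the nearest-neighbour model and its DLR measures in
`Literature/Probability/LatticeModels/HighDimTrivialityMoments.lean` (`aizenman_evenMoment_deviation_le`,
`newman_evenMoment_le`, `oddSpinCorrelation_eq_zero` ⟹ the MGF bound, through the PROVED summation
theorem `abs_mgf_sub_exp_le_of_moment_bounds`), and REUSES that summation theorem: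

`panis_mgfDeviation_le_ursellFourBoxSum_of_moments :
  panis_evenMoment_deviation_le → newman_gaussian_evenMoment_le → panis_mgfDeviation_le_ursellFourBoxSum`

(constant `C₁ = 16 · 3/2 = 24`) — an implication whose first hypothesis has since been REFUTED
(§Verdict clean-up below: the theorem is kept, vacuous, for its two users; its former corollaries
`panis_thm12_of_moments` and `LongRangeTrivialityOnZ3.of_moments` are retired). The two
moment-level `Prop`s are

* `panis_evenMoment_deviation_le` — **DEPRECATED (misstated: false as stated, refuted in the tree;
  §Verdict clean-up below), no longer a named fact** — the first display of the proof of Theorem 5.5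
  (p. 21, the one following "Using Proposition 4.6 one gets for `n ≥ 2`"): `|⟨T^{2n}⟩ - (2n)!/(2ⁿn!)⟨T²⟩ⁿ| ≤
  (3/2)(2n)⁴⟨T_{|f|}^{2n-4}⟩‖f‖_∞⁴ S(β,L,f)` — Aizenman's deviation from Wick's law (Prop. 4.6, random
  currents) smeared against `f`, AS PRINTED; vendored for the algebraic couplings of Theorem 1.2, in
  infinite volume; its corrected form is `panis_evenMoment_deviation_le_wick` (`…Wick`, PROVED);
* `newman_gaussian_evenMoment_le` — Newman 1975, Theorem 5, eq. (2.8): for a spin-½ ferromagnet with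
  pair interactions (an "Ising model of Lee–Yang type", eq. (1.1) and Theorem 1) and `X = ∑ λ_xσ_x`,
  `λ ≥ 0`, `E X^{2m} ≤ (2m)!/(2^m m!) (E X²)^m`; vendored AS PRINTED, i.e. in FINITE volume
  (`LongRangeIsing.expectIn J Λ β 0`, any `J ≥ 0`, `β ≥ 0`), the passage to the infinite-volume state
  being proved here (`LongRangeIsing.state_smeared_even_pow_le`).

What is PROVED to make the summation theorem (stated for a probability `Measure`) applicable to the
barrier's state `LongRangeIsing.state J β 0` (a `limUnder` of finite-volume Gibbs expectations along
boxes, namespace `LongRangeIsing`):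

* **the window law.** For a finite window `B ⊆ ℤ^d`, the cylinder functions
  `1{σ|_B = τ} = ∏_{x∈B}(1 + τ_xσ_x)/2 = 2^{-|B|}∑_{S⊆B} τ_Sσ_S` (`cylinderFn`, `cylinderFn_eq_sum`) are
  finite combinations of spin products, so by the monotone box limit of `LongRangeTrivialityOnZ3Proofs`
  (`tendsto_expectIn_box`, `J ≥ 0`, `β ≥ 0`) their box expectations converge
  (`tendsto_expectIn_box_cylinderFn`); the limits `w(τ) ≥ 0` sum to `1` (`windowWeight`,
  `sum_windowWeight`) and `⟨G(σ|_B)⟩_{Λ_L} → ∑_τ G(τ)w(τ) = ⟨G(σ|_B)⟩_{J,0,β}` for EVERY `G : {±1}^B → ℝ`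
  (`tendsto_expectIn_box_comp_restrictTo`, `state_comp_restrictTo`); packaged as the probability measure
  `windowMeasure J β B` (`PMF.ofFintype … |>.toMeasure`) with
  `⟨G(σ|_B)⟩_{J,0,β} = ∫ G d(windowMeasure)` (`state_comp_restrictTo_eq_integral`);
* the smeared observable `T_{f,L,β}` reads only the spins of a window containing the lattice support
  (`smeared_eq_smeared_glue_restrictTo`), so its moments and exponential moments are integrals against the
  window law (`state_fun_smeared_eq_integral`) and limits of the box expectations
  (`tendsto_expectIn_box_fun_smeared`);
* **flip symmetry**: at `h = 0` the finite-volume weight is even and `T` is odd under `τ ↦ -τ`, so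
  `⟨T^{2m+1}⟩_{Λ} = 0` in every box containing the support and `⟨T^{2m+1}⟩_{J,0,β} = 0`
  (`expectIn_eq_zero_of_odd`, `state_smeared_odd_pow`) — the analogue of `oddSpinCorrelation_eq_zero`, here a
  theorem with no uniqueness input because the state is the free-boundary box limit by definition;
* Newman's inequality passes to the limit (`state_smeared_even_pow_le`).

When this file landed, the barrier `LongRangeTrivialityOnZ3` rested on: `panis_evenMoment_deviation_le`
(Aizenman's Prop. 12.1 / Panis Prop. 4.6 smeared — random currents), `newman_gaussian_evenMoment_le`
(Lee–Yang), and `panis_ursellFourBoxSum_le` (tree diagram bound + reflection-positivity infrared bounds +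
MMS; Panis p. 22, where `d + 2η - 4 ≥ d - 2(α∧2)` with `η = (2-α)₊` admissible by Remark 5.3). Since
then the first was refuted and replaced (below), the second discharged
(`newman_gaussian_evenMoment_le_holds`, `…Newman`), and the barrier itself proved outright
(`LongRangeTrivialityOnZ3_holds`, `LongRangeTrivialityOnZ3Holds.lean`).

## Verdict clean-up (2026-08-16): `panis_evenMoment_deviation_le` is misstated — deprecated, not restated here

The tenured prove seat of `panis_evenMoment_deviation_le` returned the verdict MISSTATED (false as
stated). Re-verified against the source and the tree, the verdict stands:

* **Source.** arXiv:2309.05797, proof of Theorem 5.5, p. 21 (materialised text, p. 21 l. 51): the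
  display reads `… ≤ (3/2)(2n)⁴ ⟨T_{|f|,L,β}(σ)^{2n-4}⟩_β ‖f‖_∞⁴ S(β,L,f)` — the `def` transcribes
  it faithfully; it is the PRINTED display that over-claims. Proposition 4.6 (p. 20, "Deviation from
  Wick's law", `d ≥ 2`, `n ≥ 2`) bounds `|⟨σ_{x₁}⋯σ_{x₂ₙ}⟩_β - ∑_π ∏⟨σσ⟩_β|` by
  `(3/2) ∑_{i<j<k<l} |U₄^β(x_i,x_j,x_k,x_l)| ∑_{π pairing of {1,…,2n}∖{i,j,k,l}} ∏_{j=1}^{n-2} ⟨σσ⟩_β`;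
  smeared against `∏_m f(x_m/L)`, that pairing sum is the Gaussian moment
  `(2n-4)!/(2^{n-2}(n-2)!) ⟨T_{|f|,L,β}²⟩_β^{n-2}` (Aizenman, CDM 2020, (7.6)–(7.10)), which
  DOMINATES `⟨T_{|f|,L,β}^{2n-4}⟩_β` (Newman's Gaussian domination) — so the printed right-hand side is
  the smaller one, and the display is strictly stronger than what Proposition 4.6 yields.
* **Tree.** `not_panis_evenMoment_deviation_le_of_criticalBeta_pos :
  panis_criticalBeta_pos → ¬ panis_evenMoment_deviation_le` (`LongRangeTrivialityOnZ3Wick.lean`, p20452;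
  `d = 2`, `C₀ = 1`, `α = 1/2`, `β = β_c`, `L = R = 1`, a bump seen by the single site `0`, `n = 12`:
  `((24)!/(2¹²12!) - 1)Σ₁⁻¹² ≤ (3/2)·24⁴·Σ₁⁻¹⁰·4·9⁴/Σ₁²` is false) together with
  `panis_criticalBeta_pos_holds` (`LongRangeTrivialityOnZ3CriticalBeta.lean`) gives
  `¬ panis_evenMoment_deviation_le` outright (re-checked 2026-08-16: the term
  `not_panis_evenMoment_deviation_le_of_criticalBeta_pos panis_criticalBeta_pos_holds` elaborates and
  closes on `propext`, `Classical.choice`, `Quot.sound`).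
* **Corrected statement (RESTATED under a new name, already in the tree — not re-declared here, which
  would duplicate it):** `panis_evenMoment_deviation_le_wick` (`LongRangeTrivialityOnZ3Wick.lean`; the
  display with `⟨T_{|f|,L,β}^{2n-4}⟩_β` replaced by `(2n-4)!/(2^{n-2}(n-2)!)⟨T_{|f|,L,β}²⟩_β^{n-2}`, same
  hypotheses, same cite), PROVED: `panis_evenMoment_deviation_le_wick_holds`
  (`LongRangeTrivialityOnZ3WickHolds.lean`). Everything the misstated display was vendored for is now a
  theorem: `panis_mgfDeviation_le_ursellFourBoxSum_of_wick` (`…Wick`),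
  `panis_mgfDeviation_le_ursellFourBoxSum_holds` (`…LeeYang`), `panis_thm12_holds` (`…Thm12Holds`),
  `LongRangeTrivialityOnZ3_holds` (`…Holds`).
* **Treatment.** The `def` keeps its name and body — its refutation names it, and eleven theorems of
  six sibling files (`…UrsellSum`, `…Susceptibility`, `…NoSlidingScale`, `…MomentsGHS`, `…Thm12Facts`,
  and `panis_mgfDeviation_le_ursellFourBoxSum_of_moments` below) still take it as a hypothesis, now
  vacuously — and carries `@[deprecated]` (message: what is wrong, the refutation, the replacement);
  it is no longer offered as a named fact (D-0014: a false `Prop` is not a hypothesis to discharge).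
  `panis_mgfDeviation_le_ursellFourBoxSum_of_moments` is kept for its two users (`…UrsellSum`,
  `…NoSlidingScale`), its vacuity recorded on its docstring; the unreferenced corollaries
  `panis_thm12_of_moments` and `LongRangeTrivialityOnZ3.of_moments` (the same vacuous implication
  composed with `panis_thm12_of_inputs` / `LongRangeTrivialityOnZ3.of_thm12`) are deleted — their
  non-vacuous counterparts are `panis_thm12_of_wick` and `LongRangeTrivialityOnZ3.of_wick` (`…Wick`).

## References

* R. Panis, arXiv:2309.05797 (2023) = Ann. Probab. 54 (2026): proof of Theorem 5.5 (p. 21, first two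
  displays), Proposition 4.6, Remark 5.3/5.4 [Panis2023Triviality] (held; read).
* C. M. Newman, Comm. Math. Phys. 41 (1975) 1–9: eq. (1.1), Theorem 1, §2 (type 𝓛), Theorem 5
  eq. (2.8) [Newman1975] (held; read pp. 1–3).
* M. Aizenman, H. Duminil-Copin, Ann. Math. 194 (2021), §6.3 (the same summation, nearest-neighbour)
  [AizenmanDuminilCopinAnnals2021] — through `abs_mgf_sub_exp_le_of_moment_bounds`.
-/

noncomputable section

namespace Literature.Barriers.CriticalPhenomena

open Literature.Probability.LatticeModels Literature.Probability.Percolation Filter Topology Finset MeasureTheory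
open scoped symmDiff ENNReal Nat

namespace LongRangeIsing

variable {d : ℕ}

/-! ### The infinite-volume state seen through a finite window: a probability measure -/

section Window

variable (J : Site d → Site d → ℝ) (β : ℝ) (B : Finset (Site d))

/-- Restriction of a configuration of `ℤ^d` to the window `B`. [folklore] -/
def restrictTo (σ : SpinConfig (Site d)) : SpinConfig ↥B := fun x => σ x

/-- The cylinder function `1{σ|_B = τ}` in product form `∏_{x ∈ B} (1 + τ_x σ_x)/2`. [folklore] -/
def cylinderFn (τ : SpinConfig ↥B) (σ : SpinConfig (Site d)) : ℝ :=
  ∏ x : ↥B, (1 + spinAt x τ * spinAt (x : Site d) σ) / 2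

/-- Two different signs multiply to `-1`. [folklore] -/
theorem units_cast_mul_cast_of_ne {u v : ℤˣ} (h : u ≠ v) : ((u : ℤ) : ℝ) * ((v : ℤ) : ℝ) = -1 := by
  rcases Int.units_eq_one_or u with hu | hu <;> rcases Int.units_eq_one_or v with hv | hv <;>
    simp_all

/-- `1{σ|_B = τ}(σ) = 1` when `τ = σ|_B`. [folklore] -/
theorem cylinderFn_restrictTo (σ : SpinConfig (Site d)) : cylinderFn B (restrictTo B σ) σ = 1 := by
  rw [cylinderFn]
  refine Finset.prod_eq_one fun x _ => ?_
  have h : spinAt x (restrictTo B σ) * spinAt (x : Site d) σ = 1 := spinAt_mul_self (x : Site d) σ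
  rw [h]
  norm_num

/-- `1{σ|_B = τ}(σ) = 0` when `τ ≠ σ|_B`. [folklore] -/
theorem cylinderFn_of_ne {τ : SpinConfig ↥B} {σ : SpinConfig (Site d)} (h : τ ≠ restrictTo B σ) :
    cylinderFn B τ σ = 0 := by
  obtain ⟨x, hx⟩ : ∃ x : ↥B, τ x ≠ σ x := by
    by_contra hall
    push Not at hall
    exact h (funext hall)
  rw [cylinderFn]
  refine Finset.prod_eq_zero (Finset.mem_univ x) ?_
  rw [spinAt, spinAt, units_cast_mul_cast_of_ne hx]
  norm_num

/-- `∑_τ F(τ) 1{σ|_B = τ} = F(σ|_B)`. [folklore] -/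
theorem sum_mul_cylinderFn (F : SpinConfig ↥B → ℝ) (σ : SpinConfig (Site d)) :
    ∑ τ : SpinConfig ↥B, F τ * cylinderFn B τ σ = F (restrictTo B σ) := by
  rw [Finset.sum_eq_single (restrictTo B σ)]
  · rw [cylinderFn_restrictTo, mul_one]
  · intro τ _ hτ
    rw [cylinderFn_of_ne B hτ, mul_zero]
  · intro h
    exact absurd (Finset.mem_univ _) h

/-- `1{σ|_B = τ} ≥ 0`. [folklore] -/
theorem cylinderFn_nonneg (τ : SpinConfig ↥B) (σ : SpinConfig (Site d)) : 0 ≤ cylinderFn B τ σ := by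
  rw [cylinderFn]
  refine Finset.prod_nonneg fun x _ => ?_
  have h1 : |spinAt x τ * spinAt (x : Site d) σ| = 1 := by rw [abs_mul, abs_spinAt, abs_spinAt, mul_one]
  have h2 : -1 ≤ spinAt x τ * spinAt (x : Site d) σ := by
    have := neg_abs_le (spinAt x τ * spinAt (x : Site d) σ)
    rwa [h1] at this
  linarith

/-- **Expansion of the cylinder function in spin products**:
`1{σ|_B = τ} = 2^{-|B|} ∑_{S ⊆ B} τ_S σ_S`. [folklore] -/
theorem cylinderFn_eq_sum (τ : SpinConfig ↥B) (σ : SpinConfig (Site d)) :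
    cylinderFn B τ σ = ((2 : ℝ) ^ Fintype.card ↥B)⁻¹ *
      ∑ S : Finset ↥B, spinProduct S τ * spinProduct (S.map (Function.Embedding.subtype _)) σ := by
  rw [cylinderFn, Finset.prod_div_distrib, Finset.prod_const, Finset.card_univ, div_eq_inv_mul,
    Finset.prod_one_add, Finset.powerset_univ]
  congr 1
  refine Finset.sum_congr rfl fun S _ => ?_
  rw [Finset.prod_mul_distrib, spinProduct, spinProduct, Finset.prod_map]
  rfl

/-- The finite-volume expectations of a cylinder function converge along boxes to its
infinite-volume expectation (`β ≥ 0`, `J ≥ 0`; linear combination of `tendsto_expectIn_box`). [folklore] -/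
theorem tendsto_expectIn_box_cylinderFn (hβ : 0 ≤ β) (hJ : ∀ x y, 0 ≤ J x y) (τ : SpinConfig ↥B) :
    Tendsto (fun L : ℕ => expectIn J (box d L) β 0 (cylinderFn B τ)) atTop
      (𝓝 (state J β 0 (cylinderFn B τ))) := by
  set c : ℝ := ((2 : ℝ) ^ Fintype.card ↥B)⁻¹ with hc
  have hobs : (cylinderFn B τ : SpinConfig (Site d) → ℝ) = fun σ => c * ∑ S : Finset ↥B,
      spinProduct S τ * spinProduct (S.map (Function.Embedding.subtype _)) σ :=
    funext fun σ => cylinderFn_eq_sum B τ σ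
  have hlin : ∀ L : ℕ, expectIn J (box d L) β 0 (cylinderFn B τ) = c * ∑ S : Finset ↥B,
      spinProduct S τ * expectIn J (box d L) β 0 (spinProduct (S.map (Function.Embedding.subtype _))) := by
    intro L
    rw [hobs, expectIn_const_mul, expectIn_finset_sum]
    congr 1
    refine Finset.sum_congr rfl fun S _ => ?_
    rw [expectIn_const_mul]
  have hconv : Tendsto (fun L : ℕ => expectIn J (box d L) β 0 (cylinderFn B τ)) atTop
      (𝓝 (c * ∑ S : Finset ↥B, spinProduct S τ *
        state J β 0 (spinProduct (S.map (Function.Embedding.subtype _))))) := by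
    simp_rw [hlin]
    exact (tendsto_finsetSum _ fun S _ => (tendsto_expectIn_box J β hβ hJ _).const_mul _).const_mul c
  rwa [state, hconv.limUnder_eq]

/-- The weight of the window configuration `τ`: `w(τ) = ⟨1{σ|_B = τ}⟩_{J,0,β}`. [folklore] -/
def windowWeight (τ : SpinConfig ↥B) : ℝ := state J β 0 (cylinderFn B τ)

/-- `w(τ) ≥ 0`. [folklore] -/
theorem windowWeight_nonneg (hβ : 0 ≤ β) (hJ : ∀ x y, 0 ≤ J x y) (τ : SpinConfig ↥B) :
    0 ≤ windowWeight J β B τ :=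
  ge_of_tendsto' (tendsto_expectIn_box_cylinderFn J β B hβ hJ τ) fun _ =>
    expectIn_nonneg J _ β 0 (cylinderFn_nonneg B τ)

/-- **The state of a window observable**: for every function `G` of the spins in `B`,
`⟨G(σ|_B)⟩_{Λ_L,J,0,β} → ∑_τ G(τ) w(τ)`. [folklore] -/
theorem tendsto_expectIn_box_comp_restrictTo (hβ : 0 ≤ β) (hJ : ∀ x y, 0 ≤ J x y) (G : SpinConfig ↥B → ℝ) :
    Tendsto (fun L : ℕ => expectIn J (box d L) β 0 (fun σ => G (restrictTo B σ))) atTop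
      (𝓝 (∑ τ : SpinConfig ↥B, G τ * windowWeight J β B τ)) := by
  have hobs : (fun σ : SpinConfig (Site d) => G (restrictTo B σ)) =
      fun σ => ∑ τ : SpinConfig ↥B, G τ * cylinderFn B τ σ :=
    funext fun σ => (sum_mul_cylinderFn B G σ).symm
  have hlin : ∀ L : ℕ, expectIn J (box d L) β 0 (fun σ => G (restrictTo B σ)) =
      ∑ τ : SpinConfig ↥B, G τ * expectIn J (box d L) β 0 (cylinderFn B τ) := by
    intro L
    rw [hobs, expectIn_finset_sum]
    refine Finset.sum_congr rfl fun τ _ => ?_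
    rw [expectIn_const_mul]
  simp_rw [hlin]
  exact tendsto_finsetSum _ fun τ _ => (tendsto_expectIn_box_cylinderFn J β B hβ hJ τ).const_mul _

/-- `⟨G(σ|_B)⟩_{J,0,β} = ∑_τ G(τ) w(τ)`. [folklore] -/
theorem state_comp_restrictTo (hβ : 0 ≤ β) (hJ : ∀ x y, 0 ≤ J x y) (G : SpinConfig ↥B → ℝ) :
    state J β 0 (fun σ => G (restrictTo B σ)) = ∑ τ : SpinConfig ↥B, G τ * windowWeight J β B τ :=
  (tendsto_expectIn_box_comp_restrictTo J β B hβ hJ G).limUnder_eq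

/-- `∑_τ w(τ) = 1`. [folklore] -/
theorem sum_windowWeight (hβ : 0 ≤ β) (hJ : ∀ x y, 0 ≤ J x y) :
    ∑ τ : SpinConfig ↥B, windowWeight J β B τ = 1 := by
  have h := state_comp_restrictTo J β B hβ hJ fun _ => 1
  simp only [one_mul] at h
  rw [← h, state_const]

/-- **The window law**: the probability mass function `τ ↦ w(τ)` on `{±1}^B`. [folklore] -/
def windowPMF (hβ : 0 ≤ β) (hJ : ∀ x y, 0 ≤ J x y) : PMF (SpinConfig ↥B) :=
  PMF.ofFintype (fun τ => ENNReal.ofReal (windowWeight J β B τ)) (by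
    rw [← ENNReal.ofReal_sum_of_nonneg fun τ _ => windowWeight_nonneg J β B hβ hJ τ,
      sum_windowWeight J β B hβ hJ, ENNReal.ofReal_one])

/-- **The marginal of the infinite-volume state on the window `B`** as a probability measure on
`{±1}^B`. [folklore] -/
def windowMeasure (hβ : 0 ≤ β) (hJ : ∀ x y, 0 ≤ J x y) : Measure (SpinConfig ↥B) :=
  (windowPMF J β B hβ hJ).toMeasure

/-- The window law is a probability measure (an instance for the tree's own `windowMeasure`; it
overrides nothing). [folklore] -/
instance windowMeasure.isProbabilityMeasure (hβ : 0 ≤ β) (hJ : ∀ x y, 0 ≤ J x y) :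
    IsProbabilityMeasure (windowMeasure J β B hβ hJ) := by
  unfold windowMeasure
  infer_instance

/-- Integrals against the window law are the weighted sums. [folklore] -/
theorem integral_windowMeasure (hβ : 0 ≤ β) (hJ : ∀ x y, 0 ≤ J x y) (G : SpinConfig ↥B → ℝ) :
    ∫ τ, G τ ∂(windowMeasure J β B hβ hJ) = ∑ τ : SpinConfig ↥B, G τ * windowWeight J β B τ := by
  rw [windowMeasure, PMF.integral_eq_sum]
  refine Finset.sum_congr rfl fun τ _ => ?_
  rw [windowPMF, PMF.ofFintype_apply, ENNReal.toReal_ofReal (windowWeight_nonneg J β B hβ hJ τ),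
    smul_eq_mul, mul_comm]

/-- **The infinite-volume state restricted to a finite window is integration against the window
law**: `⟨G(σ|_B)⟩_{J,0,β} = ∫ G dμ_B` for every `G : {±1}^B → ℝ` (`β ≥ 0`, `J ≥ 0`). [folklore] -/
theorem state_comp_restrictTo_eq_integral (hβ : 0 ≤ β) (hJ : ∀ x y, 0 ≤ J x y) (G : SpinConfig ↥B → ℝ) :
    state J β 0 (fun σ => G (restrictTo B σ)) = ∫ τ, G τ ∂(windowMeasure J β B hβ hJ) := by
  rw [integral_windowMeasure, state_comp_restrictTo J β B hβ hJ G]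

end Window

/-! ### Smeared observables live on a window; flip symmetry; moments in the limit -/

section SmearedWindow

variable (J : Site d → Site d → ℝ) (β : ℝ)

/-- A function supported in `[-R,R]^d` vanishes at `x/L` unless `x ∈ Λ_{RL}`. [folklore] -/
theorem mem_box_mul_of_apply_ne_zero {f : EuclideanSpace ℝ (Fin d) → ℝ} {R : ℕ}
    (hfR : ∀ x, f x ≠ 0 → ∀ i, |x i| ≤ R) {L : ℕ} (hL : 1 ≤ L) (x : Site d)
    (hx : f ((L : ℝ)⁻¹ • siteVec x) ≠ 0) : x ∈ box d (R * L) := by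
  have hLpos : (0 : ℝ) < L := by exact_mod_cast hL
  rw [mem_box]
  intro i
  have h := hfR _ hx i
  rw [PiLp.smul_apply, siteVec_apply, smul_eq_mul, abs_mul, abs_of_pos (inv_pos.2 hLpos),
    inv_mul_le_iff₀ hLpos] at h
  have h3 : |(x i : ℝ)| ≤ ((R * L : ℕ) : ℝ) := by
    push_cast
    calc |(x i : ℝ)| ≤ (L : ℝ) * R := h
      _ = (R : ℝ) * L := mul_comm _ _
  obtain ⟨h4, h5⟩ := abs_le.1 h3
  constructor
  · exact_mod_cast h4
  · exact_mod_cast h5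

/-- The smeared observable only reads the spins in a window containing the (lattice) support:
`T_{f,L,β}(σ) = T_{f,L,β}(σ|_B · free)`. [folklore] -/
theorem smeared_eq_smeared_glue_restrictTo (L : ℕ) (f : EuclideanSpace ℝ (Fin d) → ℝ) {B : Finset (Site d)}
    (hsupp : ∀ x : Site d, f ((L : ℝ)⁻¹ • siteVec x) ≠ 0 → x ∈ B) (σ : SpinConfig (Site d)) :
    smeared J β L f σ = smeared J β L f (glue B (restrictTo B σ) .free) := by
  have hsupp' : ∀ x : Site d, f ((L : ℝ)⁻¹ • siteVec x) ≠ 0 → x ∈ box d 0 ∪ B := fun x hx =>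
    Finset.mem_union_right _ (hsupp x hx)
  have key : ∀ σ' : SpinConfig (Site d), smeared J β L f σ' =
      (∑ x ∈ B, f ((L : ℝ)⁻¹ • siteVec x) * spinAt x σ') / Real.sqrt (blockVariance J β L) := by
    intro σ'
    rw [smeared]
    congr 1
    apply finsum_eq_sum_of_support_subset
    intro x hx
    rw [Function.mem_support] at hx
    exact Finset.mem_coe.2 (hsupp x fun h0 => hx (by rw [h0, zero_mul]))
  rw [key, key]
  congr 1
  refine Finset.sum_congr rfl fun x hx => ?_
  rw [spinAt_glue_of_mem _ _ hx]
  rfl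

/-- Inside `Λ`, flipping the finite configuration flips the spin. [folklore] -/
theorem spinAt_glue_neg_of_mem {Λ : Finset (Site d)} (τ : SpinConfig ↥Λ) {x : Site d} (hx : x ∈ Λ) :
    spinAt x (glue Λ (-τ) .free) = -spinAt x (glue Λ τ .free) := by
  rw [spinAt_glue_of_mem _ _ hx, spinAt_glue_of_mem _ _ hx, spinAt, spinAt, Pi.neg_apply, Units.val_neg,
    Int.cast_neg]

/-- The zero-field Hamiltonian is even under the global flip of the spins of `Λ`. [folklore] -/
theorem pairHamiltonian_glue_neg (Λ : Finset (Site d)) (τ : SpinConfig ↥Λ) :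
    pairHamiltonian J Λ 0 (glue Λ (-τ) .free) = pairHamiltonian J Λ 0 (glue Λ τ .free) := by
  simp only [pairHamiltonian, zero_mul, sub_zero]
  congr 2
  refine Finset.sum_congr rfl fun x hx => Finset.sum_congr rfl fun y hy => ?_
  rw [spinAt_glue_neg_of_mem τ hx, spinAt_glue_neg_of_mem τ hy]
  ring

/-- **Flip symmetry at zero field**: an observable odd under the flip of the spins of `Λ` has zero
finite-volume expectation. [folklore] -/
theorem expectIn_eq_zero_of_odd (Λ : Finset (Site d)) {F : SpinConfig (Site d) → ℝ}
    (hF : ∀ τ : SpinConfig ↥Λ, F (glue Λ (-τ) .free) = -F (glue Λ τ .free)) : expectIn J Λ β 0 F = 0 := by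
  have hw : ∀ τ : SpinConfig ↥Λ, pairGibbsWeight J Λ β 0 (-τ) = pairGibbsWeight J Λ β 0 τ := fun τ => by
    rw [pairGibbsWeight, pairGibbsWeight, pairHamiltonian_glue_neg]
  have hsum : ∑ τ : SpinConfig ↥Λ, F (glue Λ τ .free) * pairGibbsWeight J Λ β 0 τ = 0 := by
    have h := (Equiv.sum_comp (Equiv.neg (SpinConfig ↥Λ))
      (fun τ => F (glue Λ τ .free) * pairGibbsWeight J Λ β 0 τ)).symm
    simp only [Equiv.neg_apply, hF, hw, neg_mul, Finset.sum_neg_distrib] at h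
    linarith
  rw [expectIn, hsum, zero_div]

/-- **Odd moments of the smeared observable vanish**, `⟨T_{f,L,β}^{2m+1}⟩_{J,0,β} = 0` (flip symmetry
in every box containing the lattice support, then the limit). [cite: Panis2023Triviality, proof of Theorem 5.5 (summation over even moments only), p. 21] -/
theorem state_smeared_odd_pow (L : ℕ) (f : EuclideanSpace ℝ (Fin d) → ℝ) {B : Finset (Site d)}
    (hsupp : ∀ x : Site d, f ((L : ℝ)⁻¹ • siteVec x) ≠ 0 → x ∈ B) (m : ℕ) :
    state J β 0 (fun σ => smeared J β L f σ ^ (2 * m + 1)) = 0 := by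
  obtain ⟨L₀, hL₀⟩ := exists_forall_subset_box d B
  refine Tendsto.limUnder_eq (tendsto_const_nhds.congr' ?_)
  filter_upwards [eventually_ge_atTop L₀] with L' hL'
  symm
  apply expectIn_eq_zero_of_odd
  intro τ
  have hsuppL : ∀ x : Site d, f ((L : ℝ)⁻¹ • siteVec x) ≠ 0 → x ∈ box d L' := fun x hx => hL₀ L' hL' (hsupp x hx)
  have key : ∀ σ' : SpinConfig (Site d), smeared J β L f σ' =
      (∑ x ∈ box d L', f ((L : ℝ)⁻¹ • siteVec x) * spinAt x σ') / Real.sqrt (blockVariance J β L) := by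
    intro σ'
    rw [smeared]
    congr 1
    apply finsum_eq_sum_of_support_subset
    intro x hx
    rw [Function.mem_support] at hx
    exact Finset.mem_coe.2 (hsuppL x fun h0 => hx (by rw [h0, zero_mul]))
  have hflip : smeared J β L f (glue (box d L') (-τ) .free) = -smeared J β L f (glue (box d L') τ .free) := by
    rw [key, key, ← neg_div, ← Finset.sum_neg_distrib]
    congr 1
    refine Finset.sum_congr rfl fun x hx => ?_
    rw [spinAt_glue_neg_of_mem τ hx]
    ring
  rw [hflip, Odd.neg_pow ⟨m, rfl⟩]

/-- Moments of the smeared observable as integrals against the window law. [folklore] -/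
theorem state_fun_smeared_eq_integral (hβ : 0 ≤ β) (hJ : ∀ x y, 0 ≤ J x y) (L : ℕ)
    (f : EuclideanSpace ℝ (Fin d) → ℝ) {B : Finset (Site d)}
    (hsupp : ∀ x : Site d, f ((L : ℝ)⁻¹ • siteVec x) ≠ 0 → x ∈ B) (ψ : ℝ → ℝ) :
    state J β 0 (fun σ => ψ (smeared J β L f σ)) =
      ∫ τ, ψ (smeared J β L f (glue B τ .free)) ∂(windowMeasure J β B hβ hJ) := by
  set G : SpinConfig ↥B → ℝ := fun τ => ψ (smeared J β L f (glue B τ .free)) with hG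
  have hobs : (fun σ => ψ (smeared J β L f σ)) = fun σ => G (restrictTo B σ) :=
    funext fun σ => congrArg ψ (smeared_eq_smeared_glue_restrictTo J β L f hsupp σ)
  rw [hobs]
  exact state_comp_restrictTo_eq_integral J β B hβ hJ G

/-- Finite-volume moments of the smeared observable converge to the infinite-volume ones. [folklore] -/
theorem tendsto_expectIn_box_fun_smeared (hβ : 0 ≤ β) (hJ : ∀ x y, 0 ≤ J x y) (L : ℕ)
    (f : EuclideanSpace ℝ (Fin d) → ℝ) {B : Finset (Site d)}
    (hsupp : ∀ x : Site d, f ((L : ℝ)⁻¹ • siteVec x) ≠ 0 → x ∈ B) (ψ : ℝ → ℝ) :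
    Tendsto (fun L' : ℕ => expectIn J (box d L') β 0 (fun σ => ψ (smeared J β L f σ))) atTop
      (𝓝 (state J β 0 (fun σ => ψ (smeared J β L f σ)))) := by
  set G : SpinConfig ↥B → ℝ := fun τ => ψ (smeared J β L f (glue B τ .free)) with hG
  have hobs : (fun σ => ψ (smeared J β L f σ)) = fun σ => G (restrictTo B σ) :=
    funext fun σ => congrArg ψ (smeared_eq_smeared_glue_restrictTo J β L f hsupp σ)
  rw [hobs]
  have h := tendsto_expectIn_box_comp_restrictTo J β B hβ hJ G
  rwa [← state_comp_restrictTo J β B hβ hJ G] at h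

end SmearedWindow

end LongRangeIsing

open LongRangeIsing

/-! ### The deprecated (misstated) moment display, and Newman's Gaussian domination -/

/-- **Deprecated — MISSTATED (false as stated; refuted in the tree); no longer a named fact. Use
`panis_evenMoment_deviation_le_wick` (`LongRangeTrivialityOnZ3Wick.lean`, PROVED by
`panis_evenMoment_deviation_le_wick_holds`, `LongRangeTrivialityOnZ3WickHolds.lean`).** The statement
is kept verbatim (name and body) only because its refutation names it and sibling files still take it
as a — now vacuous — hypothesis (module docstring, §Verdict clean-up).

**What it transcribes (faithfully).** Panis 2023, proof of Theorem 5.5, its first (numbered)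
display, p. 21 — the one following "Using Proposition 4.6 [Aizenman's deviation from Wick's law,
via the random current representation] one gets for `n ≥ 2` (the inequality being trivial for
`n = 0, 1`)":
`|⟨T_{f,L,β}(σ)^{2n}⟩_β - (2n)!/(2ⁿn!) ⟨T_{f,L,β}(σ)²⟩_βⁿ| ≤ (3/2)(2n)⁴ ⟨T_{|f|,L,β}(σ)^{2n-4}⟩_β ‖f‖_∞⁴ S(β,L,f)`,
where `S(β,L,f) := ∑_{x₁,…,x₄∈Λ_{r_fL}} |U₄^β(x₁,…,x₄)| / Σ_L(β)²`; under the hypotheses of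
Theorem 5.5, here for `J_{x,y} = C₀|x-y|₁^{-d-α}`, `C₀, α > 0`, `d - 2(α∧2) > 0` (Remark 5.4),
quantified over `0 < β ≤ β_c`, natural `L ≥ 1`, `Λ_{RL}` for any natural `R ≥ 1` with `f = 0` off
`[-R,R]^d` in place of `Λ_{r_fL}`, and all `n ≥ 2`.

**What is wrong.** So quantified, the printed display is false: for a bump `f` seen by a single
lattice site (`L = 1`, `T = σ₀/√Σ₁`) the left side is `((2n-1)!! - 1)Σ₁⁻ⁿ` and the right side
`O((2n)⁴)Σ₁⁻ⁿ`. **Refutation (kept):** `not_panis_evenMoment_deviation_le_of_criticalBeta_pos :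
panis_criticalBeta_pos → ¬ panis_evenMoment_deviation_le` (`LongRangeTrivialityOnZ3Wick.lean`;
`d = 2`, `C₀ = 1`, `α = 1/2`, `β = β_c`, `L = R = 1`, `n = 12`), unconditional with
`panis_criticalBeta_pos_holds` (`LongRangeTrivialityOnZ3CriticalBeta.lean`). The display does not
follow from Proposition 4.6 as printed (p. 20), whose right-hand side carries the PAIRING SUM of the
remaining `2n-4` points: smeared, that is the Gaussian moment
`(2n-4)!/(2^{n-2}(n-2)!)⟨T_{|f|,L,β}²⟩_β^{n-2}` (Aizenman, CDM 2020, (7.6)–(7.10)), which dominates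
`⟨T_{|f|,L,β}^{2n-4}⟩_β`, not the other way round. **Corrected statement:**
`panis_evenMoment_deviation_le_wick` — this display with that factor corrected, same hypotheses, same
cite — declared and PROVED downstream (not re-declared here); the summation over `n` it was vendored
for is `panis_mgfDeviation_le_ursellFourBoxSum_of_wick`, and `panis_mgfDeviation_le_ursellFourBoxSum_holds`,
`panis_thm12_holds`, `LongRangeTrivialityOnZ3_holds` no longer involve any form of it as a hypothesis.
No `panis_evenMoment_deviation_le_holds` can exist.
[cite: Panis2023Triviality, proof of Theorem 5.5, first display (p. 21), as printed (false as stated, see above)] -/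
@[deprecated "misstated (false as stated): refuted by \
    Literature.Barriers.CriticalPhenomena.not_panis_evenMoment_deviation_le_of_criticalBeta_pos \
    (LongRangeTrivialityOnZ3Wick.lean) with panis_criticalBeta_pos_holds (LongRangeTrivialityOnZ3CriticalBeta.lean); \
    corrected statement: Literature.Barriers.CriticalPhenomena.panis_evenMoment_deviation_le_wick \
    (LongRangeTrivialityOnZ3Wick.lean), proved by panis_evenMoment_deviation_le_wick_holds \
    (LongRangeTrivialityOnZ3WickHolds.lean)" (since := "2026-08-16")]
def panis_evenMoment_deviation_le : Prop :=
  ∀ (d : ℕ), 1 ≤ d → ∀ (C₀ α : ℝ), 0 < C₀ → 0 < α → 0 < (d : ℝ) - 2 * min α 2 →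
    ∀ (β : ℝ), 0 < β → β ≤ LongRangeIsing.criticalBeta (algebraicCoupling d C₀ α) →
      ∀ (L R : ℕ), 1 ≤ L → 1 ≤ R →
        ∀ (f : EuclideanSpace ℝ (Fin d) → ℝ), Continuous f → (∀ x, f x ≠ 0 → ∀ i, |x i| ≤ R) →
          ∀ (n : ℕ), 2 ≤ n →
            |state (algebraicCoupling d C₀ α) β 0 (fun σ => smeared (algebraicCoupling d C₀ α) β L f σ ^ (2 * n)) -
                ((2 * n)! : ℝ) / (2 ^ n * n !) *
                  state (algebraicCoupling d C₀ α) β 0 (fun σ => smeared (algebraicCoupling d C₀ α) β L f σ ^ 2) ^ n| ≤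
              3 / 2 * (2 * n : ℝ) ^ 4 *
                state (algebraicCoupling d C₀ α) β 0
                  (fun σ => smeared (algebraicCoupling d C₀ α) β L (fun x => |f x|) σ ^ (2 * n - 4)) *
                (⨆ x, |f x|) ^ 4 * ursellFourBoxSum (algebraicCoupling d C₀ α) β L R

/-- NAMED FACT — **Newman's Gaussian domination of even moments (Newman 1975, Theorem 5,
eq. (2.8)).** For a random variable `X` "of type 𝓛" the odd moments vanish and
`s_{2m} = E(X^{2m}) ≤ (2m)!/(2^m m!) s₂^m` for `m = 1, 2, …`; and (Theorem 1 with §2) for a general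
Ising model with two-body ferromagnetic interactions, eq. (1.1) — the measure
`∝ exp(∑_{j,k} J_{jk} X_jX_k) ∏ dρ_j(X_j)`, `J_{jk} ≥ 0`, each `ρ_j` even, of Lee–Yang type (here
spin ½, `ρ_j = (δ₁+δ₋₁)/2`, whose transform `cosh z` has purely imaginary zeros) — the variable
`X(λ) = ∑_j λ_j X_j` is of type 𝓛 whenever all `λ_j ≥ 0`. Vendored for the finite-volume
free-boundary Gibbs expectation `⟨·⟩_{Λ,J,0,β}` of a ferromagnetic pair interaction `J ≥ 0` on
`ℤ^d` at `β ≥ 0` (couplings `(β/2)J_{x,y} ≥ 0`) and `X = ∑_{x∈Λ} λ_x σ_x`, `λ ≥ 0`. Users take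
`(h : newman_gaussian_evenMoment_le)`.
[cite: Newman1975, Theorem 5, eq. (2.8) (with Theorem 1 and eq. (1.1))] -/
def newman_gaussian_evenMoment_le : Prop :=
  ∀ (d : ℕ) (J : Site d → Site d → ℝ), (∀ x y, 0 ≤ J x y) → ∀ (β : ℝ), 0 ≤ β →
    ∀ (Λ : Finset (Site d)) (lam : Site d → ℝ), (∀ x, 0 ≤ lam x) → ∀ (m : ℕ),
      expectIn J Λ β 0 (fun σ => (∑ x ∈ Λ, lam x * spinAt x σ) ^ (2 * m)) ≤
        ((2 * m)! : ℝ) / (2 ^ m * m !) * expectIn J Λ β 0 (fun σ => (∑ x ∈ Λ, lam x * spinAt x σ) ^ 2) ^ m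

namespace LongRangeIsing

variable {d : ℕ}

/-- **Gaussian domination in infinite volume**: granted Newman's finite-volume inequality, for
`f ≥ 0` vanishing off `Λ_{RL}` at scale `L`, `⟨T_{f,L,β}^{2m}⟩_{J,0,β} ≤ (2m)!/(2^m m!) ⟨T_{f,L,β}²⟩^m`
(`J ≥ 0`, `β ≥ 0`; pass to the limit along boxes). [cite: Newman1975, Theorem 5, eq. (2.8)] -/
theorem state_smeared_even_pow_le (hN : newman_gaussian_evenMoment_le) (J : Site d → Site d → ℝ)
    (hJ : ∀ x y, 0 ≤ J x y) {β : ℝ} (hβ : 0 ≤ β) (L : ℕ) (f : EuclideanSpace ℝ (Fin d) → ℝ)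
    (hf0 : ∀ x, 0 ≤ f x) {B : Finset (Site d)} (hsupp : ∀ x : Site d, f ((L : ℝ)⁻¹ • siteVec x) ≠ 0 → x ∈ B)
    (m : ℕ) :
    state J β 0 (fun σ => smeared J β L f σ ^ (2 * m)) ≤
      ((2 * m)! : ℝ) / (2 ^ m * m !) * state J β 0 (fun σ => smeared J β L f σ ^ 2) ^ m := by
  obtain ⟨L₀, hL₀⟩ := exists_forall_subset_box d B
  set lam : Site d → ℝ := fun x => f ((L : ℝ)⁻¹ • siteVec x) / Real.sqrt (blockVariance J β L) with hlam
  have hlam0 : ∀ x, 0 ≤ lam x := fun x => div_nonneg (hf0 _) (Real.sqrt_nonneg _)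
  -- in a box containing `B`, `T_{f,L,β} = ∑_{x ∈ Λ} λ_x σ_x`
  have hT : ∀ L' : ℕ, L₀ ≤ L' → ∀ σ : SpinConfig (Site d),
      smeared J β L f σ = ∑ x ∈ box d L', lam x * spinAt x σ := by
    intro L' hL' σ
    have hsuppL : ∀ x : Site d, f ((L : ℝ)⁻¹ • siteVec x) ≠ 0 → x ∈ box d L' := fun x hx => hL₀ L' hL' (hsupp x hx)
    have hsub : Function.support (fun x : Site d => f ((L : ℝ)⁻¹ • siteVec x) * spinAt x σ) ⊆ ↑(box d L') := by
      intro x hx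
      rw [Function.mem_support] at hx
      exact Finset.mem_coe.2 (hsuppL x fun h0 => hx (by rw [h0, zero_mul]))
    rw [smeared, finsum_eq_sum_of_support_subset _ hsub, Finset.sum_div]
    refine Finset.sum_congr rfl fun x _ => ?_
    rw [hlam]
    ring
  have hev : ∀ᶠ L' : ℕ in atTop, expectIn J (box d L') β 0 (fun σ => smeared J β L f σ ^ (2 * m)) ≤
      ((2 * m)! : ℝ) / (2 ^ m * m !) * expectIn J (box d L') β 0 (fun σ => smeared J β L f σ ^ 2) ^ m := by
    filter_upwards [eventually_ge_atTop L₀] with L' hL'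
    have h := hN d J hJ β hβ (box d L') lam hlam0 m
    have e1 : (fun σ => smeared J β L f σ ^ (2 * m)) = fun σ => (∑ x ∈ box d L', lam x * spinAt x σ) ^ (2 * m) :=
      funext fun σ => by rw [hT L' hL' σ]
    have e2 : (fun σ => smeared J β L f σ ^ 2) = fun σ => (∑ x ∈ box d L', lam x * spinAt x σ) ^ 2 :=
      funext fun σ => by rw [hT L' hL' σ]
    rw [e1, e2]
    exact h
  have h1 := tendsto_expectIn_box_fun_smeared J β hβ hJ L f hsupp fun t => t ^ (2 * m)
  have h2 := ((tendsto_expectIn_box_fun_smeared J β hβ hJ L f hsupp fun t => t ^ 2).pow m).const_mul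
    (((2 * m)! : ℝ) / (2 ^ m * m !))
  exact le_of_tendsto_of_tendsto h1 h2 hev

end LongRangeIsing

/-! ### The moment-generating-function bound from the moment-level `Prop`s (vacuous record) -/

-- names the `@[deprecated]` (refuted) `panis_evenMoment_deviation_le` on purpose: kept, vacuous, for its users in
-- `…UrsellSum` / `…NoSlidingScale` (verdict clean-up 2026-08-16); REMOVE-WHEN those users are retired
set_option linter.deprecated false in
/-- **`panis_mgfDeviation_le_ursellFourBoxSum` from the moment-level `Prop`s** (the summation of the
proof of Theorem 5.5, "Multiplying by `z^{2n}/(2n)!` and summing [the moment display] over `n`", carried out by the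
tree's `abs_mgf_sub_exp_le_of_moment_bounds` on the window law of the infinite-volume state, with
Newman's Gaussian domination for `T_{|f|,L,β}` and the flip symmetry `⟨T^{2m+1}⟩ = 0`; the constant is
`C₁ = 16 · 3/2 = 24`). **Vacuous since the verdict clean-up of 2026-08-16:** the hypothesis
`panis_evenMoment_deviation_le` is refuted (`not_panis_evenMoment_deviation_le_of_criticalBeta_pos`,
`…Wick`, with `panis_criticalBeta_pos_holds`); the theorem is kept unchanged for its users
`LongRangeTrivialityOnZ3.of_twoPoint` (`…UrsellSum`) and `LongRangeTrivialityOnZ3.of_twoPoint_mms`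
(`…NoSlidingScale`). The same summation from the corrected display is
`panis_mgfDeviation_le_ursellFourBoxSum_of_wick` (`…Wick`), and the conclusion is a theorem outright,
`panis_mgfDeviation_le_ursellFourBoxSum_holds` (`…LeeYang`).
[cite: Panis2023Triviality, proof of Theorem 5.5, first two displays (p. 21)] -/
theorem panis_mgfDeviation_le_ursellFourBoxSum_of_moments (h51 : panis_evenMoment_deviation_le)
    (hN : newman_gaussian_evenMoment_le) : panis_mgfDeviation_le_ursellFourBoxSum := by
  intro d hd C₀ α hC₀ hα hexp
  refine ⟨24, by norm_num, ?_⟩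
  intro β hβ hβc L R hL hR f hf hfR z
  set J := algebraicCoupling d C₀ α with hJdef
  have hJ : ∀ x y, 0 ≤ J x y := algebraicCoupling_nonneg hC₀.le α
  have hβ0 : 0 ≤ β := hβ.le
  set B : Finset (Site d) := box d (R * L) with hB
  have hsupp : ∀ x : Site d, f ((L : ℝ)⁻¹ • siteVec x) ≠ 0 → x ∈ B :=
    fun x hx => mem_box_mul_of_apply_ne_zero hfR hL x hx
  have hfaR : ∀ x, (fun x => |f x|) x ≠ 0 → ∀ i, |x i| ≤ R := fun x hx => hfR x (fun h0 => hx (by simp [h0]))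
  have hsuppa : ∀ x : Site d, (fun x => |f x|) ((L : ℝ)⁻¹ • siteVec x) ≠ 0 → x ∈ B :=
    fun x hx => mem_box_mul_of_apply_ne_zero hfaR hL x hx
  -- the window law and the two random variables
  set μ := windowMeasure J β B hβ0 hJ with hμ
  set X : SpinConfig ↥B → ℝ := fun τ => smeared J β L f (glue B τ .free) with hX
  set Y : SpinConfig ↥B → ℝ := fun τ => smeared J β L (fun x => |f x|) (glue B τ .free) with hY
  have hSX : ∀ ψ : ℝ → ℝ, state J β 0 (fun σ => ψ (smeared J β L f σ)) = ∫ τ, ψ (X τ) ∂μ :=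
    fun ψ => state_fun_smeared_eq_integral J β hβ0 hJ L f hsupp ψ
  have hSY : ∀ ψ : ℝ → ℝ, state J β 0 (fun σ => ψ (smeared J β L (fun x => |f x|) σ)) = ∫ τ, ψ (Y τ) ∂μ :=
    fun ψ => state_fun_smeared_eq_integral J β hβ0 hJ L (fun x => |f x|) hsuppa ψ
  -- hypotheses of the summation theorem
  have hXm : Measurable X := measurable_of_finite X
  have hXb : ∀ τ, |X τ| ≤ ∑ τ' : SpinConfig ↥B, |X τ'| := fun τ =>
    Finset.single_le_sum (f := fun τ' => |X τ'|) (fun τ' _ => abs_nonneg _) (Finset.mem_univ τ)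
  set F4 : ℝ := (⨆ x, |f x|) ^ 4 with hF4
  have hF40 : 0 ≤ F4 := pow_nonneg (Real.iSup_nonneg fun x => abs_nonneg (f x)) 4
  set S : ℝ := ursellFourBoxSum J β L R with hS
  have hS0 : 0 ≤ S := ursellFourBoxSum_nonneg J β L R
  set E : ℝ := 3 / 2 * F4 * S with hE
  have hE0 : 0 ≤ E := by positivity
  have hdev : ∀ n : ℕ, 2 ≤ n →
      |(∫ τ, X τ ^ (2 * n) ∂μ) - ((2 * n)! : ℝ) / (2 ^ n * n !) * (∫ τ, X τ ^ 2 ∂μ) ^ n|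
        ≤ (2 * n : ℝ) ^ 4 * E * ∫ τ, Y τ ^ (2 * n - 4) ∂μ := by
    intro n hn
    have h := h51 d hd C₀ α hC₀ hα hexp β hβ hβc L R hL hR f hf hfR n hn
    rw [hSX (fun t => t ^ (2 * n)), hSX (fun t => t ^ 2), hSY (fun t => t ^ (2 * n - 4))] at h
    calc |(∫ τ, X τ ^ (2 * n) ∂μ) - ((2 * n)! : ℝ) / (2 ^ n * n !) * (∫ τ, X τ ^ 2 ∂μ) ^ n|
        ≤ 3 / 2 * (2 * n : ℝ) ^ 4 * (∫ τ, Y τ ^ (2 * n - 4) ∂μ) * F4 * S := h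
      _ = (2 * n : ℝ) ^ 4 * E * ∫ τ, Y τ ^ (2 * n - 4) ∂μ := by rw [hE]; ring
  have hdom : ∀ n : ℕ, ∫ τ, Y τ ^ (2 * n) ∂μ ≤ ((2 * n)! : ℝ) / (2 ^ n * n !) * (∫ τ, Y τ ^ 2 ∂μ) ^ n := by
    intro n
    have h := state_smeared_even_pow_le hN J hJ hβ0 L (fun x => |f x|) (fun x => abs_nonneg _) hsuppa n
    rwa [hSY (fun t => t ^ (2 * n)), hSY (fun t => t ^ 2)] at h
  have hodd : ∀ n : ℕ, ∫ τ, X τ ^ (2 * n + 1) ∂μ = 0 := by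
    intro n
    rw [← hSX (fun t => t ^ (2 * n + 1))]
    exact state_smeared_odd_pow J β L f hsupp n
  have key := abs_mgf_sub_exp_le_of_moment_bounds (μ := μ) hXm hXb hE0 hdev hdom hodd z
  -- back to the state
  have e1 : state J β 0 (fun σ => Real.exp (z * smeared J β L f σ)) = ∫ τ, Real.exp (z * X τ) ∂μ :=
    hSX fun t => Real.exp (z * t)
  have e2 : state J β 0 (fun σ => smeared J β L f σ ^ 2) = ∫ τ, X τ ^ 2 ∂μ := hSX fun t => t ^ 2
  have e3 : state J β 0 (fun σ => smeared J β L (fun x => |f x|) σ ^ 2) = ∫ τ, Y τ ^ 2 ∂μ := hSY fun t => t ^ 2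
  rw [mgfDeviation, e1, e2, e3]
  calc |(∫ τ, Real.exp (z * X τ) ∂μ) - Real.exp (z ^ 2 / 2 * ∫ τ, X τ ^ 2 ∂μ)|
      ≤ 16 * E * z ^ 4 * Real.exp (z ^ 2 / 2 * ∫ τ, Y τ ^ 2 ∂μ) := key
    _ = 24 * z ^ 4 * Real.exp (z ^ 2 / 2 * ∫ τ, Y τ ^ 2 ∂μ) * F4 * S := by rw [hE]; ring

end Literature.Barriers.CriticalPhenomena

end
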